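import Mathlib
import HarnessLib
import Summits.AtomisticToContinuum.FouriersLaw.Theses.JunctionLocality
import Summits.AtomisticToContinuum.FouriersLaw.Theorems.JunctionLocalitySuperadditiveResistanceDeviceLiouville
import Summits.AtomisticToContinuum.FouriersLaw.Theorems.JunctionLocalitySuperadditiveResistancePlainAdjoint
import Summits.AtomisticToContinuum.FouriersLaw.Theorems.JunctionLocalitySuperadditiveResistanceStubDeviceForwardFieldsAux6
import Summits.AtomisticToContinuum.FouriersLaw.Theorems.JunctionLocalityConductanceLowerBoundStubRowSum
import Summits.AtomisticToContinuum.FouriersLaw.Theorems.JunctionLocalityConductanceLowerBoundRelocForwardFieldAnchors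
import Summits.AtomisticToContinuum.FouriersLaw.Theorems.JunctionLocalityConductanceLowerBoundRelocForwardFieldOfResolventBound
import Summits.AtomisticToContinuum.FouriersLaw.Theorems.JunctionLocalityConductanceLowerBoundStubKuboLinkResolventAux1

/-!
# ENDλ — the Abelian limit `⟨u^λ, p_0² − T⟩ → ⟨g, p_0² − T⟩` at the end placement
(stub `stub_kuboLink_resolvent` of line `cold-bath-relocation-walk`, crux stmt-AtomisticToContinuum-11749
`JunctionLocality.ConductanceLowerBound`; `--supports` stmt-AtomisticToContinuum-11749)

Setting: ONE `L`-site Hamiltonian `H` of `P = pinnedChain ω₂ lam β γ` (all parameters `> 0`), its Gibbs state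
`μ_T` (`T > 0`), `L ≥ 2`, and the plain equilibrium generator `L_{T,T} = X_H + γ (S_0 + S_{L−1})`
(`generator_eq_liouvilleOp_add`, `bathOp_bathWeight_eq_thermo`), `k_0 := p_0² − T` (`kin L 0 − T`).
The plain FORWARD FIELD `g` is the classical mean-zero `C² ∩ L²(μ_T)` solution of `L_{T,T} g = −k_0` (landed
existence `relocForwardField_end`; unique by the `L²(μ_T)`-Liouville theorem `eq_zero_of_liouville_pinnedChain`), the
RESOLVENT FIELDS are the `C² ∩ L²(μ_T)` solutions `u = u^λ` of `λ u − L_{T,T} u = k_0`, `λ > 0`.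

* `stub_kuboLink_resolvent` (registered): for every `ε > 0` there is `λ₀ > 0` such that for all `λ ∈ (0, λ₀)`,
  every resolvent field `u^λ` and every forward field `g`: `|⟨u^λ, k_0⟩_{μ_T} − ⟨g, k_0⟩_{μ_T}| < ε`.

Proof.  Let `v = v^λ` be a BACKWARD resolvent field, `λ v − (−X_H v + γ (S_0 + S_{L−1}) v) = k_0` (landed
`exists_resolventField` with `σ = −1`).  The cutoff-removed cross Green identity `integral_cross_eq` (forward
`σ = 1` pair against backward pair) gives, with the forward pairs `(u, k_0 − λu)` and `(g, k_0)` and the backward pair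
`(v, k_0 − λv)`:  `⟨v, k_0⟩ = ⟨u, k_0⟩` and `⟨v, k_0⟩ = ⟨g, k_0⟩ − λ⟨g, v⟩`, hence
`⟨u^λ, k_0⟩ − ⟨g, k_0⟩ = −λ ⟨v^λ, g⟩`, and `λ⟨v^λ, g⟩ → 0` as `λ → 0⁺` is the weak Abelian limit (mean ergodic
theorem) `relocEnd_meanErgodic` for the backward operator against the fixed observable `g ∈ L²(μ_T)`.  The threshold
`λ₀` is chosen for the canonical forward field `g₀` of `relocForwardField_end`; an arbitrary `g` of the statement equals
`g₀` by uniqueness.  No definitions; standard axioms.  References: folklore (resolvent identity + mean ergodic theorem).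
-/

noncomputable section

open MeasureTheory Filter Topology
open scoped ContDiff
open Literature.MathematicalPhysics.KineticTheory.HeatConduction
open Summit.AtomisticToContinuum.FouriersLaw.Theorems.SuperadditiveResistance.DeviceLiouville
  (kin thermo liouvilleOp bathOp liouvilleOp_sub bathOp_sub eq_zero_of_liouville_pinnedChain
    generator_eq_liouvilleOp_add)
open Summit.AtomisticToContinuum.FouriersLaw.Cruxes.SuperadditiveResistance.FloatingProbeBypassLaplacian
  (exists_resolventField pinnedChain_memLp_two_kin)
open Summit.AtomisticToContinuum.FouriersLaw.Cruxes.ConductanceLowerBound.ForecastSensitivity (integral_cross_eq)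

namespace Summit.AtomisticToContinuum.FouriersLaw.Cruxes.ConductanceLowerBound.ColdBathRelocationWalk

/-- **ENDλ — THE ABELIAN LIMIT AT THE END PLACEMENT (fixed `N`).**  For `pinnedChain ω₂ lam β γ` (all parameters
`> 0`), `T > 0`, `L ≥ 2` and `ε > 0` there is `λ₀ > 0` such that for every `λ ∈ (0, λ₀)`, every `C² ∩ L²(μ_T)` solution
`u` of `λu − (X_H u + γ(S_0 + S_{L−1})u) = p_0² − T` and every classical mean-zero `C² ∩ L²(μ_T)` forward field `g` of the
plain chain (`L_{T,T} g = −(p_0² − T)`):  `|⟨u, p_0² − T⟩_{μ_T} − ⟨g, p_0² − T⟩_{μ_T}| < ε`.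
(`⟨u^λ, k_0⟩ − ⟨g, k_0⟩ = −λ⟨v^λ, g⟩` by two cross Green identities against the backward resolvent field `v^λ`, and
`λ⟨v^λ, g⟩ → 0` by the mean ergodic theorem `relocEnd_meanErgodic`; `g` is unique.) [folklore] -/
theorem stub_kuboLink_resolvent :
    ∀ (ω₂ lam β γ T : ℝ), 0 < ω₂ → 0 < lam → 0 < β → 0 < γ → 0 < T →
      ∀ (L : ℕ), 2 ≤ L → ∀ ε : ℝ, 0 < ε → ∃ l₀ : ℝ, 0 < l₀ ∧ ∀ (l : ℝ), 0 < l → l < l₀ →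
        ∀ u : PhaseSpace L → ℝ, ContDiff ℝ 2 u → MemLp u 2 ((pinnedChain ω₂ lam β γ).gibbsMeasure L T) →
        (∀ x, l * u x - (liouvilleOp (pinnedChain ω₂ lam β γ) L u x + γ * (thermo L 0 T u x + thermo L (L - 1) T u x)) =
          kin L 0 x - T) →
        ∀ g : PhaseSpace L → ℝ, ContDiff ℝ 2 g → MemLp g 2 ((pinnedChain ω₂ lam β γ).gibbsMeasure L T) →
        ∫ x, g x ∂((pinnedChain ω₂ lam β γ).gibbsMeasure L T) = 0 →
        (∀ x, (pinnedChain ω₂ lam β γ).generator L T T g x = -(kin L 0 x - T)) →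
        |(∫ x, u x * (kin L 0 x - T) ∂((pinnedChain ω₂ lam β γ).gibbsMeasure L T)) -
            ∫ x, g x * (kin L 0 x - T) ∂((pinnedChain ω₂ lam β γ).gibbsMeasure L T)| < ε := by
  intro ω₂ lam β γ T hω hl hβ hγ hT L hL ε hε
  have hL0 : 0 < L := by omega
  set P := pinnedChain ω₂ lam β γ with hP
  haveI : IsProbabilityMeasure (P.gibbsMeasure L T) :=
    pinnedChain_isProbabilityMeasure_gibbsMeasure hω hl.le hβ.le γ L hT
  -- the plain chain's bath weights `𝟙_0 + 𝟙_{L−1}`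
  have hB : ∀ i, 0 ≤ OscillatorChain.bathWeight L i := fun i => by
    unfold OscillatorChain.bathWeight
    split_ifs <;> norm_num
  have hB0 : 0 < OscillatorChain.bathWeight L ⟨0, hL0⟩ := by
    unfold OscillatorChain.bathWeight
    simp only [if_true]
    split_ifs <;> norm_num
  -- the source `k_0 = p_0² − T`
  have hks : ContDiff ℝ ∞ (fun x : PhaseSpace L => kin L 0 x - T) := contDiff_kin_sub_const L 0 T
  have hk2 : MemLp (fun x : PhaseSpace L => kin L 0 x - T) 2 (P.gibbsMeasure L T) :=
    (pinnedChain_memLp_two_kin hω hl.le hβ.le γ L 0 hT).sub (memLp_const T)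
  -- the canonical plain forward field `g₀` and its pair form
  obtain ⟨g₀, hg₀C, hg₀L2, hg₀mean, hg₀pde⟩ := relocForwardField_end ω₂ lam β γ T hω hl hβ hγ hT L hL
  have hg₀pair : ∀ x, 1 * liouvilleOp P L g₀ x + γ * bathOp L (OscillatorChain.bathWeight L) T g₀ x =
      -(kin L 0 x - T) := by
    intro x
    rw [one_mul, bathOp_bathWeight_eq_thermo]
    exact hg₀pde x
  -- the BACKWARD resolvent family `v l` (`σ = −1`), chosen once and for all
  have hex : ∀ l : ℝ, 0 < l → ∃ w : PhaseSpace L → ℝ, ContDiff ℝ 2 w ∧ MemLp w 2 (P.gibbsMeasure L T) ∧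
      ∀ x, l * w x - ((-1) * liouvilleOp P L w x + γ * bathOp L (OscillatorChain.bathWeight L) T w x) =
        kin L 0 x - T := by
    intro l hlpos
    obtain ⟨w, hwC, hw2, hpde⟩ := exists_resolventField hω hl.le hβ.le γ hL0 hT (neg_ne_zero.2 one_ne_zero) hγ
      hB hB0 hlpos hks hk2
    exact ⟨w, hwC.of_le (by norm_cast), hw2, hpde⟩
  choose vfam hvfam using hex
  set v : ℝ → PhaseSpace L → ℝ := fun l => if h : 0 < l then vfam l h else fun _ => 0 with hvdef
  have hv : ∀ l : ℝ, 0 < l → ContDiff ℝ 2 (v l) ∧ MemLp (v l) 2 (P.gibbsMeasure L T) ∧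
      ∀ x, l * v l x - ((-1) * liouvilleOp P L (v l) x + γ * bathOp L (OscillatorChain.bathWeight L) T (v l) x) =
        kin L 0 x - T := by
    intro l hlpos
    have e : v l = vfam l hlpos := by simp only [hvdef, dif_pos hlpos]
    rw [e]
    exact hvfam l hlpos
  -- the mean ergodic theorem for the backward operator, against the observable `g₀`
  have hvT : ∀ l : ℝ, 0 < l → ContDiff ℝ 2 (v l) ∧ MemLp (v l) 2 (P.gibbsMeasure L T) ∧
      ∀ x, l * v l x - (-liouvilleOp P L (v l) x + γ * (thermo L 0 T (v l) x + thermo L (L - 1) T (v l) x)) =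
        kin L 0 x - T := by
    intro l hlpos
    obtain ⟨h1, h2, h3⟩ := hv l hlpos
    refine ⟨h1, h2, fun x => ?_⟩
    have e := h3 x
    rw [neg_one_mul] at e
    rw [← bathOp_bathWeight_eq_thermo]
    exact e
  have hlim : Tendsto (fun l : ℝ => l * ∫ x, v l x * g₀ x ∂(P.gibbsMeasure L T)) (𝓝[>] 0) (𝓝 0) :=
    relocEnd_meanErgodic ω₂ lam β γ T hω hl.le hβ.le hγ hT L hL0 v hvT g₀ hg₀L2
  -- the threshold `l₀`
  obtain ⟨l₀, hl₀, hsmall⟩ : ∃ l₀ : ℝ, 0 < l₀ ∧ ∀ l : ℝ, 0 < l → l < l₀ →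
      |l * ∫ x, v l x * g₀ x ∂(P.gibbsMeasure L T)| < ε := by
    have hevε : ∀ᶠ l in 𝓝[>] (0 : ℝ), |l * ∫ x, v l x * g₀ x ∂(P.gibbsMeasure L T)| < ε := by
      refine (Metric.tendsto_nhds.1 hlim ε hε).mono fun l h => ?_
      rwa [Real.dist_0_eq_abs] at h
    obtain ⟨l₀, hl₀, hsub⟩ := mem_nhdsGT_iff_exists_Ioo_subset.1 hevε
    exact ⟨l₀, hl₀, fun l h1 h2 => hsub ⟨h1, h2⟩⟩
  refine ⟨l₀, hl₀, fun l hlpos hll u huC huL2 hures g hgC hgL2 hgmean hgpde => ?_⟩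
  -- `g` is the canonical forward field (uniqueness by the `L²(μ_T)`-Liouville theorem)
  have hgpair : ∀ x, 1 * liouvilleOp P L g x + γ * bathOp L (OscillatorChain.bathWeight L) T g x =
      -(kin L 0 x - T) := by
    intro x
    have e := hgpde x
    rw [generator_eq_liouvilleOp_add] at e
    rw [one_mul]
    exact e
  have hg_eq : g = g₀ := by
    have hwC : ContDiff ℝ 2 (fun y => g y - g₀ y) := hgC.sub hg₀C
    have hwL2 : MemLp (fun y => g y - g₀ y) 2 (P.gibbsMeasure L T) := hgL2.sub hg₀L2
    have hwmean : ∫ x, (fun y => g y - g₀ y) x ∂(P.gibbsMeasure L T) = 0 := by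
      simp only
      rw [integral_sub (hgL2.integrable one_le_two) (hg₀L2.integrable one_le_two), hgmean, hg₀mean, sub_zero]
    have hwpde : ∀ x, 1 * liouvilleOp P L (fun y => g y - g₀ y) x +
        γ * bathOp L (OscillatorChain.bathWeight L) T (fun y => g y - g₀ y) x = 0 := by
      intro x
      have e := hgpair x
      have e' := hg₀pair x
      rw [one_mul, liouvilleOp_sub (hgC.differentiable two_ne_zero) (hg₀C.differentiable two_ne_zero),
        bathOp_sub hgC hg₀C]
      linear_combination e - e'
    have hzero := eq_zero_of_liouville_pinnedChain hω hl.le hβ.le γ hL0 hT (OscillatorChain.bathWeight L) hB hB0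
      one_ne_zero hγ hwC hwL2 hwpde hwmean
    funext y
    exact sub_eq_zero.mp (hzero y)
  rw [hg_eq]
  -- the backward resolvent field at level `l` and the two pair forms
  obtain ⟨hvC, hvL2, hvres⟩ := hv l hlpos
  have hpv : ∀ x, -1 * liouvilleOp P L (v l) x + γ * bathOp L (OscillatorChain.bathWeight L) T (v l) x =
      -((kin L 0 x - T) - l * v l x) := by
    intro x
    have e := hvres x
    linarith
  have hpu : ∀ x, 1 * liouvilleOp P L u x + γ * bathOp L (OscillatorChain.bathWeight L) T u x =
      -((kin L 0 x - T) - l * u x) := by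
    intro x
    have e := hures x
    rw [← bathOp_bathWeight_eq_thermo] at e
    linarith
  have hkfu : MemLp (fun x => (kin L 0 x - T) - l * u x) 2 (P.gibbsMeasure L T) := hk2.sub (huL2.const_mul l)
  have hkfv : MemLp (fun x => (kin L 0 x - T) - l * v l x) 2 (P.gibbsMeasure L T) := hk2.sub (hvL2.const_mul l)
  -- two cross Green identities against the backward pair `(v, k_0 − l v)`
  have hx1 : ∫ x, v l x * ((kin L 0 x - T) - l * u x) * P.gibbsDensity L T x =
      ∫ x, u x * ((kin L 0 x - T) - l * v l x) * P.gibbsDensity L T x :=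
    integral_cross_eq hω hl.le hβ.le L hT (OscillatorChain.bathWeight L) hB 1 hγ huC hvC huL2 hkfu hvL2 hkfv
      hpu hpv
  have hx2 : ∫ x, v l x * (kin L 0 x - T) * P.gibbsDensity L T x =
      ∫ x, g₀ x * ((kin L 0 x - T) - l * v l x) * P.gibbsDensity L T x :=
    integral_cross_eq hω hl.le hβ.le L hT (OscillatorChain.bathWeight L) hB 1 hγ hg₀C hvC hg₀L2 hk2 hvL2 hkfv
      hg₀pair hpv
  have hμ1 : ∫ x, v l x * ((kin L 0 x - T) - l * u x) ∂(P.gibbsMeasure L T) =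
      ∫ x, u x * ((kin L 0 x - T) - l * v l x) ∂(P.gibbsMeasure L T) := by
    rw [P.integral_gibbsMeasure, P.integral_gibbsMeasure, hx1]
  have hμ2 : ∫ x, v l x * (kin L 0 x - T) ∂(P.gibbsMeasure L T) =
      ∫ x, g₀ x * ((kin L 0 x - T) - l * v l x) ∂(P.gibbsMeasure L T) := by
    rw [P.integral_gibbsMeasure, P.integral_gibbsMeasure, hx2]
  -- expand: `⟨v, k_0⟩ = ⟨u, k_0⟩` and `⟨v, k_0⟩ = ⟨g₀, k_0⟩ − l⟨v, g₀⟩`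
  have ivk : Integrable (fun x => v l x * (kin L 0 x - T)) (P.gibbsMeasure L T) := hvL2.integrable_mul hk2
  have ivu : Integrable (fun x => v l x * u x) (P.gibbsMeasure L T) := hvL2.integrable_mul huL2
  have iuk : Integrable (fun x => u x * (kin L 0 x - T)) (P.gibbsMeasure L T) := huL2.integrable_mul hk2
  have igk : Integrable (fun x => g₀ x * (kin L 0 x - T)) (P.gibbsMeasure L T) := hg₀L2.integrable_mul hk2
  have ivg : Integrable (fun x => v l x * g₀ x) (P.gibbsMeasure L T) := hvL2.integrable_mul hg₀L2
  have e1 : ∫ x, v l x * ((kin L 0 x - T) - l * u x) ∂(P.gibbsMeasure L T) =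
      (∫ x, v l x * (kin L 0 x - T) ∂(P.gibbsMeasure L T)) - l * ∫ x, v l x * u x ∂(P.gibbsMeasure L T) := by
    rw [← integral_const_mul, ← integral_sub ivk (ivu.const_mul l)]
    exact integral_congr_ae (ae_of_all _ fun x => by ring)
  have e2 : ∫ x, u x * ((kin L 0 x - T) - l * v l x) ∂(P.gibbsMeasure L T) =
      (∫ x, u x * (kin L 0 x - T) ∂(P.gibbsMeasure L T)) - l * ∫ x, v l x * u x ∂(P.gibbsMeasure L T) := by
    rw [← integral_const_mul, ← integral_sub iuk (ivu.const_mul l)]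
    exact integral_congr_ae (ae_of_all _ fun x => by ring)
  have e3 : ∫ x, g₀ x * ((kin L 0 x - T) - l * v l x) ∂(P.gibbsMeasure L T) =
      (∫ x, g₀ x * (kin L 0 x - T) ∂(P.gibbsMeasure L T)) - l * ∫ x, v l x * g₀ x ∂(P.gibbsMeasure L T) := by
    rw [← integral_const_mul, ← integral_sub igk (ivg.const_mul l)]
    exact integral_congr_ae (ae_of_all _ fun x => by ring)
  rw [e1, e2] at hμ1
  rw [e3] at hμ2
  have hfin : (∫ x, u x * (kin L 0 x - T) ∂(P.gibbsMeasure L T)) -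
      ∫ x, g₀ x * (kin L 0 x - T) ∂(P.gibbsMeasure L T) = -(l * ∫ x, v l x * g₀ x ∂(P.gibbsMeasure L T)) := by
    linarith
  rw [hfin, abs_neg]
  exact hsmall l hlpos hll
    
end Summit.AtomisticToContinuum.FouriersLaw.Cruxes.ConductanceLowerBound.ColdBathRelocationWalk

end
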